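import Summits.HodgeConjecture.HodgeConjecture.Theorems.EightfoldBlochSeedsChernCharacterOnBettiAnalytificationExists
import HarnessLib

/-!
# K1 (analytification bridge), step 6: frames have locally constant size; on an irreducible `X` a
# finite locally free `F` (`IsFinLocallyFreeOn F ⊤`) has a topological analytification of some rank `r`

Route `EightfoldBlochSeeds` / item `stmt-HodgeConjecture-19780` (`ChernCharacterOnBetti`), helper
(`--supports`). HONEST FRAMING: nothing here proves 19780 / 18880 / 18882 / 18883 / H2 / HC_AV / HC;
no definition, no named fact. Part of K1d (hypothesis dictionary): the existence theorem
`exists_topologicalAnalytification` asks for frames OF ONE SIZE `r` near every point; the tree's GAGA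
vocabulary (`HodgeTheory.IsFinLocallyFreeOn F U`, `AnalytifiedVectorBundle.lean`) allows the size
to vary. Here:

* `frame_card_eq` — two algebraic frames of `F` whose opens share a scheme point have the same size
  (both restrict to bases of the free `Γ(X, U ∩ U')`-module `Γ(F, U ∩ U')`, a NONTRIVIAL commutative
  ring — it maps to the residue field of the common point — hence invariant basis number);
* `exists_frames_of_isFinLocallyFreeOn` — on an IRREDUCIBLE `X` (e.g. smooth projective: integral),
  `IsFinLocallyFreeOn F ⊤` gives one size `r` of frames near every point (any two non-empty opens
  meet);
* `exists_topologicalAnalytification_of_isFinLocallyFreeOn` — hence the topological analytification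
  `(E, α)` of rank `r` exists for every `F` finite locally free on an irreducible `ℂ`-scheme.

[cite: SerreFAC1955, n°41] [cite: SerreGAGA1956, §3 n°9 Déf. 2 and §4 n°20]
-/

noncomputable section

-- single-problem summit (Problem = Summit): the mandated namespace repeats `HodgeConjecture`.
set_option linter.dupNamespace false

open CategoryTheory AlgebraicGeometry Bundle Topology
open Literature.AlgebraicGeometry.Motives Literature.AlgebraicGeometry.HodgeTheory
open Literature.AlgebraicTopology.SingularHomology Literature.AlgebraicTopology.CharacteristicClasses

namespace Summit.HodgeConjecture.HodgeConjecture.Theorems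

variable {X : SchemeOver ℂ} {F : X.left.Modules}

/-- **Frames sharing a point have the same size** (rank is well defined: `Γ(X, U ∩ U')` is a
non-trivial commutative ring, so it has invariant basis number). [cite: SerreFAC1955, n°41] -/
theorem frame_card_eq {U U' : X.left.Opens} {r r' : ℕ} {s : Fin r → Γ(F, U)} {t : Fin r' → Γ(F, U')}
    (hs : IsSectionFrame F U s) (ht : IsSectionFrame F U' t) {x : X.left} (hx : x ∈ U)
    (hx' : x ∈ U') : r = r' := by
  have hxV : x ∈ U ⊓ U' := ⟨hx, hx'⟩
  haveI : Nontrivial Γ(X.left, U ⊓ U') := (X.left.evaluation (U ⊓ U') x hxV).hom.domain_nontrivial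
  simpa using Fintype.card_congr
    ((hs.of_le (inf_le_left : U ⊓ U' ≤ U)).basis.indexEquiv (ht.of_le (inf_le_right : U ⊓ U' ≤ U')).basis)

/-- **On an irreducible scheme, a finite locally free module has frames of ONE size near every
point.** [cite: SerreFAC1955, n°41] -/
theorem exists_frames_of_isFinLocallyFreeOn [IrreducibleSpace X.left] (hF : IsFinLocallyFreeOn F ⊤) :
    ∃ r : ℕ, ∀ x : X.left, ∃ (U : X.left.Opens) (s : Fin r → Γ(F, U)), x ∈ U ∧ IsSectionFrame F U s := by
  obtain ⟨x₀⟩ := (inferInstance : Nonempty X.left)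
  obtain ⟨U₀, r, s₀, hx₀, -, hs₀⟩ := hF x₀ trivial
  refine ⟨r, fun x ↦ ?_⟩
  obtain ⟨U, r', s, hx, -, hs⟩ := hF x trivial
  obtain ⟨y, hyU₀, hyU⟩ := nonempty_preirreducible_inter U₀.2 U.2 ⟨x₀, hx₀⟩ ⟨x, hx⟩
  obtain rfl : r = r' := frame_card_eq hs₀ hs hyU₀ hyU
  exact ⟨U, s, hx, hs⟩

/-- **Existence of the topological analytification for `F` finite locally free on an irreducible
`ℂ`-scheme** (e.g. smooth projective): some rank `r`, a complex vector bundle `E` of rank `r` on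
`X(ℂ)` and Serre's comparison maps with the five properties of `exists_topologicalAnalytification`.
[cite: SerreGAGA1956, §3 n°9 Déf. 2 and §4 n°20] -/
theorem exists_topologicalAnalytification_of_isFinLocallyFreeOn [IrreducibleSpace X.left]
    (hF : IsFinLocallyFreeOn F ⊤) :
    ∃ (r : ℕ) (E : ComplexVectorBundle.{0, 0} (ComplexPoints X))
      (α : ∀ U : X.left.Opens, Γ(F, U) → ∀ P : ComplexPoints X, E.E P),
      E.rank = r ∧
      (∀ x : X.left, ∃ (U : X.left.Opens) (s : Fin r → Γ(F, U)), x ∈ U ∧ IsSectionFrame F U s) ∧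
      (∀ (U : X.left.Opens) (σ τ : Γ(F, U)) (P : ComplexPoints X),
          α U (σ + τ) P = α U σ P + α U τ P) ∧
      (∀ (U : X.left.Opens) (f : Γ(X.left, U)) (σ : Γ(F, U)) (P : ComplexPoints X) (h : P.pt ∈ U),
          α U (f • σ) P = P.eval U h f • α U σ P) ∧
      (∀ (U W : X.left.Opens) (hWU : W ≤ U) (σ : Γ(F, U)) (P : ComplexPoints X), P.pt ∈ W →
          α W (F.presheaf.map (homOfLE hWU).op σ) P = α U σ P) ∧
      (∀ (U : X.left.Opens) (σ : Γ(F, U)),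
          ContinuousOn (fun P ↦ (⟨P, α U σ P⟩ : TotalSpace E.F E.E)) {P | P.pt ∈ U}) ∧
      (∀ (U : X.left.Opens) (t : Fin r → Γ(F, U)), IsSectionFrame F U t → ∀ P : ComplexPoints X,
          P.pt ∈ U → LinearIndependent ℂ (fun j ↦ α U (t j) P) ∧
            ⊤ ≤ Submodule.span ℂ (Set.range fun j ↦ α U (t j) P)) := by
  obtain ⟨r, hr⟩ := exists_frames_of_isFinLocallyFreeOn hF
  obtain ⟨E, α, hrank, h⟩ := exists_topologicalAnalytification hr
  exact ⟨r, E, α, hrank, hr, h⟩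

/-- The smooth projective case (integral, hence irreducible). [cite: SerreGAGA1956, §4 n°20] -/
theorem exists_topologicalAnalytification_of_isSmoothProjective {n : ℕ} (hX : IsSmoothProjective n X)
    (hF : IsFinLocallyFreeOn F ⊤) :
    ∃ (r : ℕ) (E : ComplexVectorBundle.{0, 0} (ComplexPoints X))
      (α : ∀ U : X.left.Opens, Γ(F, U) → ∀ P : ComplexPoints X, E.E P),
      E.rank = r ∧
      (∀ x : X.left, ∃ (U : X.left.Opens) (s : Fin r → Γ(F, U)), x ∈ U ∧ IsSectionFrame F U s) ∧
      (∀ (U : X.left.Opens) (σ τ : Γ(F, U)) (P : ComplexPoints X),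
          α U (σ + τ) P = α U σ P + α U τ P) ∧
      (∀ (U : X.left.Opens) (f : Γ(X.left, U)) (σ : Γ(F, U)) (P : ComplexPoints X) (h : P.pt ∈ U),
          α U (f • σ) P = P.eval U h f • α U σ P) ∧
      (∀ (U W : X.left.Opens) (hWU : W ≤ U) (σ : Γ(F, U)) (P : ComplexPoints X), P.pt ∈ W →
          α W (F.presheaf.map (homOfLE hWU).op σ) P = α U σ P) ∧
      (∀ (U : X.left.Opens) (σ : Γ(F, U)),
          ContinuousOn (fun P ↦ (⟨P, α U σ P⟩ : TotalSpace E.F E.E)) {P | P.pt ∈ U}) ∧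
      (∀ (U : X.left.Opens) (t : Fin r → Γ(F, U)), IsSectionFrame F U t → ∀ P : ComplexPoints X,
          P.pt ∈ U → LinearIndependent ℂ (fun j ↦ α U (t j) P) ∧
            ⊤ ≤ Submodule.span ℂ (Set.range fun j ↦ α U (t j) P)) := by
  haveI := IsSmoothProjective.isIntegral_holds hX
  exact exists_topologicalAnalytification_of_isFinLocallyFreeOn hF

end Summit.HodgeConjecture.HodgeConjecture.Theorems

end
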